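import Literature.Claims.NS.ClayVariants
import HarnessLib

/-!
# Claim skeleton (D-0090 NS-CLAIMS, C109, QUICK / Lean-artefact row): Fox, Zenodo 10.5281/zenodo.22049018 (2026) —
# «Navier-Stokes Global Regularity — formal proof in Lean 4»

Typed skeleton of the Lean 4 artefact D. J. Fox, *Navier-Stokes Global Regularity — formal proof in Lean 4*, Zenodo
record 22049018 (21 Aug 2026, version label «v1.0-ns-m6-conditional»; bib `Fox2026NavierStokesLeanZenodo`): one zip =
GitHub snapshot `DavidFox998-navier-stokes-310212a` (toolchain Lean 4.12.0 / Mathlib v4.12.0; 133 `.lean` files),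
unpacked with a lake-free census in `run/shared/lean/pub/ns-claims/sources/Fox2026/` (lit-1 LOCATORS.md: 2 live `sorry`,
9 `axiom`s, none of either in the import cone of the top theorem). SELF-PUBLISHED ARTEFACT under adjudication —
NOTHING here asserts a step: the artefact's statements are transcribed as `def … : Prop`; the theorems below are kernel
relations about the transcribed TYPES. Locators are `file:line` in `Towers/NS/` of the snapshot. No `lake build` of the
artefact was run in-seat (4.12 pin; QUICK treatment, lead ruling 19:43:38Z (4)): the typing reads the TYPES.

## The claimed statement

* README.md l.9–19, verbatim: «STATUS: NS_M6_PROVED — Clay M6 — Path A + Path B CLOSED … `theorem NS_M6_PROVED :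
  NS_M6_OPEN` -- For all v0 in L²(R³), ∃ globally smooth solution of incompressible NS for all t>0 / `#print axioms
  NS_M6_PROVED` -- propext, Classical.choice, Quot.sound / 0 sorry · 0 OPEN · 0 axiom keyword». CLAIM.md l.1–16: «Result:
  Full resolution of Clay Millennium Problem — global smooth solutions for H⁴ data, all paths CLOSED, 0 sorry.» Zenodo
  description: «NS_M6_CLOSED conditional on NS_ESS_Criterion (Escauriaza-Seregin-Sverak)» (version tension recorded in
  the CARD §1: the deposit's metadata describes the conditional package, the zip asserts the unconditional one).
* The Lean TYPE of record — `NSPhase108LimitPass.lean:98–102`: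
  `def NS_M6_OPEN : Prop := ∀ (v₀ : EuclideanSpace ℝ (Fin 3) → EuclideanSpace ℝ (Fin 3)), MemLp v₀ 2 Measure.haar →
  ∃ v : ℝ → EuclideanSpace ℝ (Fin 3) → EuclideanSpace ℝ (Fin 3), NS_WeakSolution v v₀ ∧ ∀ t > (0:ℝ), ContDiff ℝ ⊤ (v t)`
  with `NSWeakSolutionClay.lean:60–68`: `structure NS_WeakSolution (v) (v₀) : Prop where init : v 0 = v₀;
  energy_le_L2 : ∀ t : ℝ, 0 ≤ t → ∫ x, ‖v t x‖ ^ 2 ∂Measure.haar ≤ ∫ x, ‖v 0 x‖ ^ 2 ∂Measure.haar` — whose own docstring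
  says «HONEST SCOPE: This predicate captures only the initial condition and L² energy inequality … The full distributional
  weak momentum equation and divergence-free constraint are genuine analytic gaps».
* The closing term of `theorem NS_M6_PROVED : NS_M6_OPEN` (l.169–183): after two placeholders
  `NS_MonotoneConv_OPEN := ∀ (_ : ℝ), True`, `NS_L2TendencyZero_OPEN := ∀ (_ : ℝ), True` (l.106, l.110) and
  `have _ := NS_Carleman_LimitPass_PROVED hDCT hZero` (whose type is `∀ _, True`), the goal is closed by
  `exact ⟨fun _ _ => 0, ⟨⟨rfl, fun t _ => by simp [integral_zero]⟩, fun _ _ => contDiff_const⟩⟩` — the exhibited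
  «solution» is the zero field for EVERY datum `v₀`, with `init : (fun _ _ => 0) 0 = v₀` to be closed by `rfl`.

TRANSCRIPTION: token for token into the tree's Mathlib, with `volume` for the artefact's `Measure.haar` (Lebesgue measure
on `ℝ³`; the 4.12-era additive Haar measure normalised on the unit cube is `volume`), `ContDiff ℝ ∞` for the 4.12-era
`ContDiff ℝ ⊤` (= `C^∞` before the analytic level `ω` existed), `MemLp` (current name). The README's ENGLISH sentence is
rendered separately (`ClaimedTheorem`) over the tree's genuine Navier–Stokes notion `IsClassicalNSSolutionOn`, and the
unstated identification «TYPE = sentence» is the bridge step (`Step_bridge`), as in the C110 skeleton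
(`Literature.Claims.NS.Strelzoff2026`).

## Clay delta of the TYPE (reference `Literature.Claims.NS.ClayVariants`; lit-1 LOCATORS §6)

Δ1 `ℝ³` = · Δ3 no force = · Δ4 data ANY `L²` field (no smoothness, decay or divergence condition; wider than (A)'s (4)) ·
Δ5 solution notion `NS_WeakSolution` = {`v 0 = v₀`, `L²` norm non-increasing}: NO equation, no divergence, no pressure,
no weak formulation · Δ6 conclusion `∀ t > 0, ContDiff ℝ ⊤ (v t)`: spatial smoothness at each positive time only (nothing
at `t = 0`, no joint smoothness, no energy bound (7)) · Δ7 no viscosity appears. CLAIM.md's `H⁴` sentence is a different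
statement (not in the zip as a theorem TYPE matching it; not typed). Consequently the TYPE is inhabited by a field that
solves nothing (`topTheoremType_holds` below: `v(0) = v₀`, `v(t) = 0` for `t ≠ 0`) and no `clay_of_…` exists.

## ORDERED STEP INDEX

* `TopTheoremType` — `NS_M6_OPEN` transcribed (the deposit's top theorem's TYPE).
* `Step_1` (l.181–182, the `init := rfl` slot of the closing term): for every `L²` datum, `(fun _ _ => 0) 0 = v₀` — what
  `rfl` must certify for the zero witness (false for every `v₀ ≠ 0`; as written the term cannot elaborate for a variable
  `v₀` — the README's CI claim was not re-run here).
* `Step_2` (l.182, the `energy_le_L2` slot, `by simp [integral_zero]`): the zero field's `L²` norm is non-increasing. True.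
* `Step_3` (l.183, `fun _ _ => contDiff_const`): the zero field is smooth at every `t > 0`. True.
* `Step_bridge` (README l.13–14 «`theorem NS_M6_PROVED : NS_M6_OPEN` -- For all v0 in L²(R³), ∃ globally smooth solution
  of incompressible NS for all t>0»): the TYPE implies the sentence. Since the TYPE holds outright
  (`topTheoremType_holds`), `Step_bridge ↔ ClaimedTheorem` (`step_bridge_iff_claimedTheorem`): the bridge IS the claim.
* `Step_bridgeClay` (CLAIM.md l.1 «Full resolution of Clay Millennium Problem»): the TYPE implies Clay (A)
  (`ClayVariants.clayR3.Regularity`); `step_bridgeClay_iff_clayA : Step_bridgeClay ↔ clayR3.Regularity` (the RED ↔).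
* `Step_ESS` (conditional route of the Zenodo description; `NSPhase86M6Close.lean:61–75`, declared with the `axiom`
  keyword; NOT in the import cone of `NS_M6_PROVED`): «ESS 2003» stated over the same equation-free `NS_WeakSolution`.
  Transcribed (the binder `λ` renamed `l`, `nnnorm … > ofReal λ` read as `ofReal l < ‖u t x‖ₑ`); not consumed.
* `claim_of_steps : Step_1 → Step_2 → Step_3 → Step_bridge → ClaimedTheorem` — PROVED (the artefact's own term with the
  Steps in its three slots, then the bridge).

WHAT THIS IS NOT: not a claim about NS regularity or blow-up; not a claim about any author beyond the typed locator.
-/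

noncomputable section

open Set Function Filter MeasureTheory
open scoped Topology ENNReal NNReal ContDiff

namespace Literature.Claims.NS.Fox2026

open Literature.Analysis.FluidPDE

/-! ### The artefact's TYPES, transcribed -/

/-- `structure NS_WeakSolution` (NSWeakSolutionClay.lean:60–68), transcribed: the two fields `init : v 0 = v₀` and
`energy_le_L2 : ∀ t ≥ 0, ∫‖v t x‖² ≤ ∫‖v 0 x‖²` are the WHOLE predicate (its docstring: «captures only the initial
condition and L² energy inequality»; no Navier–Stokes equation, no divergence-free condition, no pressure).
[cite: Fox2026NavierStokesLeanZenodo, Towers/NS/NSWeakSolutionClay.lean l.60–68] -/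
structure NS_WeakSolution (v : ℝ → EuclideanSpace ℝ (Fin 3) → EuclideanSpace ℝ (Fin 3))
    (v₀ : EuclideanSpace ℝ (Fin 3) → EuclideanSpace ℝ (Fin 3)) : Prop where
  init : v 0 = v₀
  energy_le_L2 : ∀ t : ℝ, 0 ≤ t → ∫ x, ‖v t x‖ ^ 2 ≤ ∫ x, ‖v 0 x‖ ^ 2

/-- `def NS_M6_OPEN` (NSPhase108LimitPass.lean:98–102) — the TYPE of the deposit's top theorem `NS_M6_PROVED`,
transcribed token for token (`volume` for `Measure.haar`, `ContDiff ℝ ∞` for the 4.12-era `ContDiff ℝ ⊤`): every `L²`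
vector field admits an `NS_WeakSolution` that is spatially smooth at each `t > 0`.
[claim: Fox2026NavierStokesLeanZenodo, status: disputed] -/
def TopTheoremType : Prop :=
  ∀ v₀ : EuclideanSpace ℝ (Fin 3) → EuclideanSpace ℝ (Fin 3), MemLp v₀ 2 volume →
    ∃ v : ℝ → EuclideanSpace ℝ (Fin 3) → EuclideanSpace ℝ (Fin 3),
      NS_WeakSolution v v₀ ∧ ∀ t : ℝ, 0 < t → ContDiff ℝ ∞ (v t)

/-- **HEADLINE — the README's sentence (README.md l.13–14, next to `theorem NS_M6_PROVED : NS_M6_OPEN`): «For all v0 in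
L²(R³), ∃ globally smooth solution of incompressible NS for all t>0»**, rendered over the tree's Navier–Stokes notion:
for every viscosity `ν > 0` and every `L²` datum there is a classical (smooth) solution `(u, p)` of the unforced
Navier–Stokes system on the open time half-line `(0, ∞)` attaining the datum in `L²` as `t → 0⁺`. (The sentence names
no data condition beyond `L²`, no energy bound and nothing at `t = 0`: Δ4/Δ6 relative to Clay (A); no `clay_of_claimed`.)
[claim: Fox2026NavierStokesLeanZenodo, status: disputed] -/
def ClaimedTheorem : Prop :=
  ∀ ν : ℝ, 0 < ν → ∀ v₀ : EuclideanSpace ℝ (Fin 3) → EuclideanSpace ℝ (Fin 3), MemLp v₀ 2 volume →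
    ∃ (u : ℝ → EuclideanSpace ℝ (Fin 3) → EuclideanSpace ℝ (Fin 3)) (p : ℝ → EuclideanSpace ℝ (Fin 3) → ℝ),
      IsClassicalNSSolutionOn (Ioi 0) ν 0 u p ∧
        Tendsto (fun t => eLpNorm (fun x => u t x - v₀ x) 2 volume) (𝓝[>] 0) (𝓝 0)

/-! ### The artefact's steps (no assertion) -/

/-- **Step 1 — the `init := rfl` slot of the closing term (NSPhase108LimitPass.lean:181–182,
`exact ⟨fun _ _ => 0, ⟨⟨rfl, …⟩, …⟩⟩`)**: for every `L²` datum `v₀`, the zero field's time-`0` slice IS `v₀` — what `rfl`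
must certify for the exhibited witness. (False for every `v₀ ≠ 0`; for a variable `v₀` the term as written does not
elaborate — the README's «527 runs, last 5 green» was not re-run here.) [claim: Fox2026NavierStokesLeanZenodo, status: disputed] -/
def Step_1 : Prop :=
  ∀ v₀ : EuclideanSpace ℝ (Fin 3) → EuclideanSpace ℝ (Fin 3), MemLp v₀ 2 volume →
    (fun (_ : ℝ) (_ : EuclideanSpace ℝ (Fin 3)) => (0 : EuclideanSpace ℝ (Fin 3))) 0 = v₀

/-- **Step 2 — the `energy_le_L2` slot (l.182, `fun t _ => by simp [integral_zero]`)**: the zero field's `L²` norm is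
non-increasing. True. [claim: Fox2026NavierStokesLeanZenodo, status: disputed] -/
def Step_2 : Prop :=
  ∀ t : ℝ, 0 ≤ t →
    ∫ x, ‖(fun (_ : ℝ) (_ : EuclideanSpace ℝ (Fin 3)) => (0 : EuclideanSpace ℝ (Fin 3))) t x‖ ^ 2 ≤
      ∫ x, ‖(fun (_ : ℝ) (_ : EuclideanSpace ℝ (Fin 3)) => (0 : EuclideanSpace ℝ (Fin 3))) 0 x‖ ^ 2

/-- **Step 3 — the smoothness slot (l.183, `fun _ _ => contDiff_const`)**: the zero field is `C^∞` in `x` at every `t > 0`.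
True. [claim: Fox2026NavierStokesLeanZenodo, status: disputed] -/
def Step_3 : Prop :=
  ∀ t : ℝ, 0 < t →
    ContDiff ℝ ∞ ((fun (_ : ℝ) (_ : EuclideanSpace ℝ (Fin 3)) => (0 : EuclideanSpace ℝ (Fin 3))) t)

/-- **The bridge — README l.13–14 identifies the TYPE with the sentence** («`theorem NS_M6_PROVED : NS_M6_OPEN` -- For all
v0 in L²(R³), ∃ globally smooth solution of incompressible NS for all t>0»): IMPLICIT step `TopTheoremType → ClaimedTheorem`.
Nothing in the deposit addresses it (the predicate's docstring declares the equation out of scope).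
[claim: Fox2026NavierStokesLeanZenodo, status: disputed] -/
def Step_bridge : Prop :=
  TopTheoremType → ClaimedTheorem

/-- **The conditional route's axiom — `axiom NS_ESS_Criterion` (NSPhase86M6Close.lean:61–75; docstring cites
Escauriaza–Seregin–Šverák, Uspekhi Mat. Nauk 58(2) (2003) 3–44), stated over the equation-free `NS_WeakSolution`**,
transcribed (binder `λ` ↦ `l`; `Measure.haar {x | nnnorm (u t x) > ENNReal.ofReal λ}` ↦ `volume {x | ofReal l < ‖u t x‖ₑ}`;
conclusion verbatim incl. its unused `T`): a uniform weak-`L³`-type bound along an `NS_WeakSolution` implies joint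
`C^∞` smoothness of `(t, x) ↦ u t x` on all of `ℝ × ℝ³`. The Zenodo description's «NS_M6_CLOSED conditional on
NS_ESS_Criterion» rests on it; it is NOT in the import cone of `NS_M6_PROVED` and is not consumed below. (The tree's
statement of the genuine ESS endpoint criterion for Leray–Hopf solutions is `Literature.NS` ns.S08 in
`Literature.Analysis.FluidPDE.NSLerayHopf`.) [claim: Fox2026NavierStokesLeanZenodo, status: disputed] -/
def Step_ESS : Prop :=
  ∀ (u₀ : EuclideanSpace ℝ (Fin 3) → EuclideanSpace ℝ (Fin 3))
    (u : ℝ → EuclideanSpace ℝ (Fin 3) → EuclideanSpace ℝ (Fin 3)),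
    NS_WeakSolution u u₀ →
    (∃ M : ℝ, ∀ t : ℝ, 0 ≤ t → ∀ l : ℝ, 0 < l →
        volume {x | ENNReal.ofReal l < ‖u t x‖ₑ} ≤ ENNReal.ofReal (M / l) ^ 3) →
    ∀ T : ℝ, 0 < T → ContDiff ℝ ∞ (fun tx : ℝ × EuclideanSpace ℝ (Fin 3) => u tx.1 tx.2)

/-! ### Kernel relations -/

/-- **RECORD (wrong-problem axis Δ5): the transcribed TYPE holds outright** — witness `v t = v₀` for `t = 0` and `v t = 0`
for `t ≠ 0`: `init` by definition, the energy inequality because `∫‖0‖² = 0 ≤ ∫‖v₀‖²` (and equality at `t = 0`), and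
`v t = 0` is smooth for `t > 0`. No equation is part of `NS_WeakSolution`, so nothing about Navier–Stokes is used.
[cite: Fox2026NavierStokesLeanZenodo, Towers/NS/NSPhase108LimitPass.lean l.98–102] -/
theorem topTheoremType_holds : TopTheoremType := by
  intro v₀ _hv₀
  refine ⟨fun t x => if t = 0 then v₀ x else 0, ⟨?_, ?_⟩, ?_⟩
  · funext x
    simp
  · intro t _ht
    by_cases h : t = 0
    · subst h
      exact le_rfl
    · have h0 : (fun x : EuclideanSpace ℝ (Fin 3) => ‖(if t = 0 then v₀ x else (0 : EuclideanSpace ℝ (Fin 3)))‖ ^ 2)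
          = fun _ => 0 := by
        funext x
        simp [h]
      show ∫ x, ‖(if t = 0 then v₀ x else (0 : EuclideanSpace ℝ (Fin 3)))‖ ^ 2 ≤
        ∫ x, ‖(if (0 : ℝ) = 0 then v₀ x else (0 : EuclideanSpace ℝ (Fin 3)))‖ ^ 2
      rw [h0, integral_zero]
      exact integral_nonneg fun x => by positivity
  · intro t ht
    have h0 : (fun x : EuclideanSpace ℝ (Fin 3) => if t = 0 then v₀ x else (0 : EuclideanSpace ℝ (Fin 3)))
        = fun _ => 0 := by
      funext x
      simp [ht.ne']
    show ContDiff ℝ ∞ (fun x : EuclideanSpace ℝ (Fin 3) => if t = 0 then v₀ x else (0 : EuclideanSpace ℝ (Fin 3)))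
    rw [h0]
    exact contDiff_const

/-- **Kernel fact: the bridge IS the claim.** Since the TYPE holds for free (`topTheoremType_holds`),
`Step_bridge ↔ ClaimedTheorem`. [cite: Fox2026NavierStokesLeanZenodo, README.md l.13–14] -/
theorem step_bridge_iff_claimedTheorem : Step_bridge ↔ ClaimedTheorem :=
  ⟨fun h => h topTheoremType_holds, fun h _ => h⟩

/-- **The Clay bridge — CLAIM.md l.1 «Result: Full resolution of Clay Millennium Problem» / README l.9 «Clay M6 — Path A +
Path B CLOSED»**: IMPLICIT step `TopTheoremType → Clay (A)` (`ClayVariants.clayR3.Regularity`, token-for-token the summit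
statement). Nothing in the deposit addresses it. [claim: Fox2026NavierStokesLeanZenodo, status: disputed] -/
def Step_bridgeClay : Prop :=
  TopTheoremType → ClayVariants.clayR3.Regularity

/-- **Kernel fact (the RED ↔): the Clay bridge IS Clay (A).** Since the TYPE holds for free (`topTheoremType_holds`),
`Step_bridgeClay ↔ ClayVariants.clayR3.Regularity`. [cite: Fox2026NavierStokesLeanZenodo, CLAIM.md l.1–16] -/
theorem step_bridgeClay_iff_clayA : Step_bridgeClay ↔ ClayVariants.clayR3.Regularity :=
  ⟨fun h => h topTheoremType_holds, fun h _ => h⟩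

/-- **The artefact's own closing term, with the Steps in its slots** (l.181–183): Steps 1–3 give `TopTheoremType` exactly as
`NS_M6_PROVED` is written (zero witness). Pure logic. [cite: Fox2026NavierStokesLeanZenodo, Towers/NS/NSPhase108LimitPass.lean l.169–183] -/
theorem topTheoremType_of_steps (h1 : Step_1) (h2 : Step_2) (h3 : Step_3) : TopTheoremType :=
  fun v₀ hv₀ => ⟨fun _ _ => 0, ⟨⟨h1 v₀ hv₀, h2⟩, h3⟩⟩

/-- **COMPOSITION**: the closing term (Steps 1–3) and the README's identification (bridge) give the sentence. Pure logic;
nothing is asserted. [claim: Fox2026NavierStokesLeanZenodo, status: disputed] -/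
theorem claim_of_steps (h1 : Step_1) (h2 : Step_2) (h3 : Step_3) (hb : Step_bridge) : ClaimedTheorem :=
  hb (topTheoremType_of_steps h1 h2 h3)

/-! ### D-0026 in-file discharges of the two true witness slots (append-only)

The `energy_le_L2` and smoothness slots of the artefact's closing term are true statements about the zero field;
they are discharged here so that the file's only undischarged Steps are the located ones (`Step_1`, kernel-false:
`…Theorems.Fox2026.not_Step_1`; `Step_ESS`, kernel-false: `…Theorems.Fox2026.not_Step_ESS`) and the bridge
`Step_bridge` (≡ `ClaimedTheorem`, `step_bridge_iff_claimedTheorem`). Locator / class of #23 unchanged. -/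

/-- **Step 2 holds**: the zero field's energy is non-increasing (`∫‖0‖² ≤ ∫‖0‖²`).
[cite: Fox2026NavierStokesLeanZenodo, Towers/NS/NSPhase108LimitPass.lean l.182] -/
theorem step_2_holds : Step_2 := fun _ _ => le_rfl

/-- **Step 3 holds**: the zero field is `C^∞` in `x` at every time.
[cite: Fox2026NavierStokesLeanZenodo, Towers/NS/NSPhase108LimitPass.lean l.183] -/
theorem step_3_holds : Step_3 := fun _ _ => contDiff_const

end Literature.Claims.NS.Fox2026

end

-- WHAT THIS IS NOT: not a claim about NS regularity or blow-up; not a claim about any author beyond the typed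
-- locator.
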